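import Summits.Ventures.HodgeRepro.TwistStabilizer

/-!
# Symmetric type squares: exactly two induced corners (seat `p1`, gen 4)

Blind re-derivation cell `pub-hodge-repro`.  Continues `TwistStabilizer.lean`.  If a non-trivial twist `g` fixes the
type square of `(Φ; p, p')`, then `g` is an involution swapping the two places (`eq_one_or_involution_of_fix`) and the
square has a `g`-invariant corner (`exists_corner_rmul_eq_of_fix`).  Here the picture is completed (Lemma 4 of
`proofs/P1.md` §8): with `Ψ` such a corner, the four corners are `Ψ, Ψ^{(p)}, Ψ^{(p')}, Ψ^{(pp')}`, and

* `rmul_flipAt` — twists move flips along: `(Ψ^{(p)})·g = (Ψ·g)^{(pg)}`;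
* `typeSquare_eq_of_mem` — the square is the same from any of its corners;
* **`rmul_eq_self_iff_of_fix`** — a corner is `g`-invariant iff it is `Ψ` or the opposite corner `Ψ^{(pp')}`: exactly
  two corners are induced from the index-two CM subfield fixed by `g`, the other two are exchanged by `g`
  (`rmul_flipAt_eq_of_fix`).
-/

open Finset

namespace HodgeRepro.TwistOrbit

variable {G : Type*} [Group G] [DecidableEq G]

/-- A flip depends on the place only: equal places give equal flips. -/
theorem flipAt_congr {c p q : G} (h : place c p = place c q) (S : Finset G) : flipAt c p S = flipAt c q S := by
  unfold flipAt; rw [h]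

/-- Twists move flips along: `(S^{(p)})·h = (S·h)^{(p h)}`. -/
theorem rmul_flipAt (c p h : G) (S : Finset G) : rmul (flipAt c p S) h = flipAt c (p * h) (rmul S h) := by
  ext x
  rw [mem_rmul, mem_flipAt, mem_flipAt, mem_rmul, ← mul_mem_place_mul_iff (h := h), inv_mul_cancel_right]

/-- The square is the same from any of its corners. -/
theorem typeSquare_eq_of_mem {c : G} {Φ Ψ : Finset G} {p p' : G} (hΨ : Ψ ∈ typeSquare c Φ p p') :
    typeSquare c Ψ p p' = typeSquare c Φ p p' := by
  simp only [typeSquare, mem_insert, mem_singleton] at hΨ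
  rcases hΨ with rfl | rfl | rfl | rfl
  · rfl
  · ext T
    simp only [typeSquare, mem_insert, mem_singleton, flipAt_flipAt, flipAt_comm c p' p]
    tauto
  · ext T
    simp only [typeSquare, mem_insert, mem_singleton, flipAt_flipAt, flipAt_comm c p' p]
    tauto
  · ext T
    simp only [typeSquare, mem_insert, mem_singleton, flipAt_flipAt, flipAt_comm c p' p]
    tauto

/-- The two places of a square are disjoint, in the form used below. -/
theorem not_mem_place_of_mem_place {c : G} (hc : IsComplexConj c) {p p' : G} (hpp' : p' ∉ place c p) {x : G}
    (hx : x ∈ place c p) : x ∉ place c p' :=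
  fun hx' => disjoint_left.1 (disjoint_place hc hpp') hx hx'

/-- **Exactly two induced corners.** Let a non-trivial twist `g` fix the square of `(Φ; p, p')` and let `Ψ` be a
`g`-invariant corner.  Then a corner is `g`-invariant iff it is `Ψ` or the opposite corner `Ψ^{(pp')}`. -/
theorem rmul_eq_self_iff_of_fix {c : G} (hc : IsComplexConj c) {Φ : Finset G} (hΦ : IsCMType c Φ) {p p' : G}
    (hpp' : p' ∉ place c p) (hq : ∃ q, q ∉ place c p ∧ q ∉ place c p') {g : G}
    (h : rmulSet (typeSquare c Φ p p') g = typeSquare c Φ p p') (h1 : g ≠ 1) {Ψ : Finset G}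
    (hΨS : Ψ ∈ typeSquare c Φ p p') (hΨg : rmul Ψ g = Ψ) {T : Finset G} (hT : T ∈ typeSquare c Φ p p') :
    rmul T g = T ↔ T = Ψ ∨ T = flipAt c p' (flipAt c p Ψ) := by
  rcases eq_one_or_involution_of_fix hc hΦ hpp' hq h with e | ⟨hgg, -, hA, hB'⟩
  · exact absurd e h1
  have hΨcm : IsCMType c Ψ := by
    simp only [typeSquare, mem_insert, mem_singleton] at hΨS
    rcases hΨS with rfl | rfl | rfl | rfl
    · exact hΦ
    · exact hΦ.flipAt hc p
    · exact hΦ.flipAt hc p'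
    · exact (hΦ.flipAt hc p).flipAt hc p'
  -- places of `p g` and `p' g`
  have hpg : place c (p * g) = place c p' := place_eq_of_mem hc hA
  have hp'g : place c (p' * g) = place c p := place_eq_of_mem hc hB'
  -- the element `a` of `Ψ` at the place of `p`, and `a g ∈ Ψ` at the place of `p'`
  obtain ⟨a, haΨ, hap⟩ := exists_mem_place_of_isCMType hΨcm p
  have hag : a * g ∈ place c p' := by
    have e : a * g ∈ place c (p * g) := mul_mem_place_mul_iff.2 hap
    rwa [hpg] at e
  have hmem : ∀ x, x ∈ Ψ ↔ x * g ∈ Ψ := by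
    intro x
    have := congrArg (fun S => x * g ∈ S) hΨg
    simp only [mem_rmul, mul_inv_cancel_right, eq_iff_iff] at this
    exact this
  have hagΨ : a * g ∈ Ψ := (hmem a).1 haΨ
  have hap' : a ∉ place c p' := not_mem_place_of_mem_place hc hpp' hap
  have hagp : a * g ∉ place c p := fun e => not_mem_place_of_mem_place hc hpp' e hag
  -- the opposite corner is `g`-invariant
  have hopp : rmul (flipAt c p' (flipAt c p Ψ)) g = flipAt c p' (flipAt c p Ψ) := by
    rw [rmul_flipAt, rmul_flipAt, hΨg, flipAt_congr hp'g, flipAt_congr hpg, flipAt_comm]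
  -- membership facts at the two places
  have ha_notflipp : a ∉ flipAt c p Ψ := by
    rw [mem_flipAt]; rintro (⟨-, h⟩ | ⟨-, h⟩)
    · exact h hap
    · exact h haΨ
  have hag_flipp : a * g ∈ flipAt c p Ψ := by
    rw [mem_flipAt]; exact Or.inl ⟨hagΨ, hagp⟩
  have hag_notflipp' : a * g ∉ flipAt c p' Ψ := by
    rw [mem_flipAt]; rintro (⟨-, h⟩ | ⟨-, h⟩)
    · exact h hag
    · exact h hagΨ
  have ha_flipp' : a ∈ flipAt c p' Ψ := by
    rw [mem_flipAt]; exact Or.inl ⟨haΨ, hap'⟩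
  have hag_notopp : a * g ∉ flipAt c p' (flipAt c p Ψ) := by
    rw [mem_flipAt]; rintro (⟨-, h⟩ | ⟨-, h⟩)
    · exact h hag
    · exact h hag_flipp
  -- the square seen from `Ψ`
  rw [← typeSquare_eq_of_mem hΨS] at hT
  simp only [typeSquare, mem_insert, mem_singleton] at hT
  rcases hT with rfl | rfl | rfl | rfl
  · exact ⟨fun _ => Or.inl rfl, fun _ => hΨg⟩
  · -- `Ψ^{(p)}`: contains `c a` (at `p`) and `a g` (at `p'`); invariance would put `c (a g)` in it
    constructor
    · intro hinv
      exfalso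
      have hca : c * a ∈ flipAt c p Ψ := by
        rw [mem_flipAt]; exact Or.inr ⟨(conj_mem_place_iff hc).2 hap, not_conj_mem_of_mem hΨcm haΨ⟩
      have hcag : c * a * g ∈ flipAt c p Ψ := by
        have := congrArg (fun S => c * a * g ∈ S) hinv
        simp only [mem_rmul, mul_inv_cancel_right, eq_iff_iff] at this
        exact this.1 hca
      rw [mul_assoc] at hcag
      exact not_conj_mem_of_mem (hΨcm.flipAt hc p) hag_flipp hcag
    · rintro (e | e)
      · exfalso; rw [e] at ha_notflipp; exact ha_notflipp haΨ
      · exfalso; rw [e] at hag_flipp; exact hag_notopp hag_flipp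
  · -- `Ψ^{(p')}`: contains `a` (at `p`) and `c (a g)` (at `p'`); invariance would put `a g` in it
    constructor
    · intro hinv
      exfalso
      have hag' : a * g ∈ flipAt c p' Ψ := by
        have := congrArg (fun S => a * g ∈ S) hinv
        simp only [mem_rmul, mul_inv_cancel_right, eq_iff_iff] at this
        exact this.1 ha_flipp'
      exact hag_notflipp' hag'
    · rintro (e | e)
      · exfalso; rw [e] at hag_notflipp'; exact hag_notflipp' hagΨ
      · exfalso
        have e' := congrArg (flipAt c p') e
        rw [flipAt_flipAt, flipAt_flipAt] at e'
        rw [← e'] at ha_notflipp; exact ha_notflipp haΨ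
  · exact ⟨fun _ => Or.inr rfl, fun _ => hopp⟩

/-- The two non-induced corners of a symmetric square are exchanged by `g`: `(Ψ^{(p)})·g = Ψ^{(p')}`. -/
theorem rmul_flipAt_eq_of_fix {c : G} (hc : IsComplexConj c) {Φ : Finset G} (hΦ : IsCMType c Φ) {p p' : G}
    (hpp' : p' ∉ place c p) (hq : ∃ q, q ∉ place c p ∧ q ∉ place c p') {g : G}
    (h : rmulSet (typeSquare c Φ p p') g = typeSquare c Φ p p') (h1 : g ≠ 1) {Ψ : Finset G}
    (hΨg : rmul Ψ g = Ψ) : rmul (flipAt c p Ψ) g = flipAt c p' Ψ := by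
  rcases eq_one_or_involution_of_fix hc hΦ hpp' hq h with e | ⟨-, -, hA, -⟩
  · exact absurd e h1
  rw [rmul_flipAt, hΨg, flipAt_congr (place_eq_of_mem hc hA)]


/-! ### Four distinct corners -/

/-- A proposition is never equivalent to its own negation. -/
theorem not_iff_not_self {P : Prop} (h : P ↔ ¬P) : False := by
  by_cases hp : P
  · exact h.1 hp hp
  · exact hp (h.2 hp)

/-- A flip at the place of `p` changes the membership of `p`. -/
theorem flipAt_ne_self (c p : G) (S : Finset G) : flipAt c p S ≠ S := by
  intro h
  have := congrArg (fun T => p ∈ T) h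
  rw [eq_iff_iff, mem_flipAt] at this
  by_cases hp : p ∈ S
  · rcases this.2 hp with ⟨-, h'⟩ | ⟨-, h'⟩
    · exact h' (mem_place_self c p)
    · exact h' hp
  · exact hp (this.1 (Or.inr ⟨mem_place_self c p, hp⟩))

/-- Membership of `p` in a flip at its own place is negated. -/
theorem mem_flipAt_self_iff (c p : G) (S : Finset G) : p ∈ flipAt c p S ↔ p ∉ S := by
  rw [mem_flipAt]
  constructor
  · rintro (⟨-, h⟩ | ⟨-, h⟩)
    · exact absurd (mem_place_self c p) h
    · exact h
  · intro h; exact Or.inr ⟨mem_place_self c p, h⟩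

/-- Membership of `x` in a flip at another place is unchanged. -/
theorem mem_flipAt_of_not_mem_place {c p x : G} (hx : x ∉ place c p) (S : Finset G) :
    x ∈ flipAt c p S ↔ x ∈ S := by
  rw [mem_flipAt]
  constructor
  · rintro (⟨h, -⟩ | ⟨h, -⟩)
    · exact h
    · exact absurd h hx
  · intro h; exact Or.inl ⟨h, hx⟩

/-- The four corners of a type square are pairwise distinct: the square has exactly four elements. -/
theorem card_typeSquare {c : G} (hc : IsComplexConj c) (Φ : Finset G) {p p' : G} (hpp' : p' ∉ place c p) :
    (typeSquare c Φ p p').card = 4 := by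
  have hp : p ∉ place c p' := fun e => hpp' ((mem_place_comm hc).1 e)
  have h1 := mem_flipAt_self_iff c p Φ
  have h2 := mem_flipAt_of_not_mem_place hp Φ
  have h3 := mem_flipAt_self_iff c p' Φ
  have h4 := mem_flipAt_of_not_mem_place hpp' Φ
  have h5 : p ∈ flipAt c p' (flipAt c p Φ) ↔ p ∉ Φ := by
    rw [mem_flipAt_of_not_mem_place hp, h1]
  have h6 : p' ∈ flipAt c p' (flipAt c p Φ) ↔ p' ∉ Φ := by
    rw [mem_flipAt_self_iff, h4]
  have ne12 : Φ ≠ flipAt c p Φ := fun e => by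
    have := congrArg (fun T => p ∈ T) e; rw [eq_iff_iff, h1] at this; exact not_iff_not_self this
  have ne13 : Φ ≠ flipAt c p' Φ := fun e => by
    have := congrArg (fun T => p' ∈ T) e; rw [eq_iff_iff, h3] at this; exact not_iff_not_self this
  have ne14 : Φ ≠ flipAt c p' (flipAt c p Φ) := fun e => by
    have := congrArg (fun T => p ∈ T) e; rw [eq_iff_iff, h5] at this; exact not_iff_not_self this
  have ne23 : flipAt c p Φ ≠ flipAt c p' Φ := fun e => by
    have := congrArg (fun T => p ∈ T) e; rw [eq_iff_iff, h1, h2] at this; exact not_iff_not_self this.symm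
  have ne24 : flipAt c p Φ ≠ flipAt c p' (flipAt c p Φ) := fun e => by
    have := congrArg (fun T => p' ∈ T) e; rw [eq_iff_iff, h4, h6] at this; exact not_iff_not_self this
  have ne34 : flipAt c p' Φ ≠ flipAt c p' (flipAt c p Φ) := fun e => by
    have := congrArg (fun T => p ∈ T) e; rw [eq_iff_iff, h2, h5] at this; exact not_iff_not_self this
  have m3 : flipAt c p' Φ ∉ ({flipAt c p' (flipAt c p Φ)} : Finset (Finset G)) := by
    rw [mem_singleton]; exact ne34
  have m2 : flipAt c p Φ ∉ ({flipAt c p' Φ, flipAt c p' (flipAt c p Φ)} : Finset (Finset G)) := by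
    rw [mem_insert, mem_singleton]; rintro (e | e)
    · exact ne23 e
    · exact ne24 e
  have m1 : Φ ∉ ({flipAt c p Φ, flipAt c p' Φ, flipAt c p' (flipAt c p Φ)} : Finset (Finset G)) := by
    rw [mem_insert, mem_insert, mem_singleton]; rintro (e | e | e)
    · exact ne12 e
    · exact ne13 e
    · exact ne14 e
  unfold typeSquare
  rw [card_insert_of_notMem m1, card_insert_of_notMem m2, card_insert_of_notMem m3, card_singleton]

end HodgeRepro.TwistOrbit
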